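import Summits.Ventures.HodgeRepro.Night3GSetForm
import Summits.Ventures.HodgeRepro.Night3GSetTwist
import Summits.Ventures.HodgeRepro.Night3GSetFormHodgeType

/-!
# The twist-equivariance of the concrete form `Q′ = ∫ x ∧ y ∧ Λ`

Blind re-derivation cell `pub-hodge-repro`, seat `night-3` (gen 7).  Imports gen 5's `Night3GSetForm` (the
`(1,1)`-monomials `ωc`, the commutative subalgebra `Ac`, the classes `Lclass` / `Λc`, the form `Qc`), gen 4's
`Night3GSetTwist` (the relabelling `relabelH n e` of the eigen-coordinates `(i, τ) ↦ (i, e τ)` — the Galois twist of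
the model) and gen 5's `Night3GSetFormHodgeType` (`coe_exteriorPower_map`).  Namespace `HodgeRepro.Night3.GSetModel`.

THE STATEMENT (NIGHT3.md §14.2).  Let `e : G ≃ G` commute with the complex conjugation `c` (`e (cρ) = c (eρ)`; the
right multiplications `ρ ↦ ρg` — the twists of gen 3 — and the left multiplication by `c` — the conjugation — do).
The relabelling `R_e = ⋀^• (relabelV n e)` is an algebra automorphism of the wedge model `⋀^• ℂ^{Fin n × G}` which

* carries the `(1,1)`-monomials to `(1,1)`-monomials, `R_e (ωc (i, ρ)) = ωc (i, e ρ)`, hence `Ac` into itself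
  (`relabelA_ωc`, `relabelAc`);
* carries the `(1,1)`-class of each factor to the `(1,1)`-class with the TWISTED COEFFICIENTS
  `a^e i ρ = [e⁻¹ρ ∈ Φ₀] a i (e⁻¹ρ) − [e⁻¹(cρ) ∈ Φ₀] a i (e⁻¹(cρ))` (`twistCoeff`; the sign bookkeeping of the places
  where the twist crosses the CM type, `ωc (i, cρ) = −ωc (i, ρ)`), hence Weil's class to Weil's class:
  `R_e (Λc a) = Λc (a^e)` (`relabelAc_Lclass`, `relabelAc_Λc`);
* multiplies the top form by the sign of the relabelling permutation `E_e : (i, τ) ↦ (i, e τ)` of the index set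
  (`ιMultiDual_univPC_map_relabelV`), and `sign E_e = (sign e)^n` (`sign_relabelPerm`).

Hence **`Qc_relabelH_relabelH`**: `Q′_{a^e} (R_e x, R_e y) = sign(E_e) · Q′_a (x, y)` — the twist is an isometry
from `(⋀^n, Q′_a)` onto `(⋀^n, Q′_{a^e})` up to the sign `(sign e)^n`, which is `+1` for every EVEN `n`
(`Qc_relabelH_relabelH_of_even`; every zero-sum corner product has an even number of factors).  The Galois twist
`ρ ↦ ρg` of gen 3 / gen 4 is the case `Qc_twist`; the conjugation `ρ ↦ cρ` is `Qc_conj`.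

READING.  The twist reduction of gen 3 («S4 on one face per twist class ⟹ S4») and the form of Lemma P step (2) live
in one picture: the Gram matrix, the non-degeneracy on the Weil space and the Poincaré reading of `Q′` on a face
transport along its twist class, with the polarisation data read in the twisted coordinates.  NOT here: `Alg` (S4 IS
`weilSpace M ≤ Alg M`), the cycle map, the `ℚ`-structure (`K = L = ℂ`).  Nothing here closes an open input of
ROUTE.md; nothing here says anything about the status of the Hodge conjecture for CM abelian varieties, which is NOT
proved by anyone in this repository.
-/

set_option autoImplicit false
open Finset Module Function
open scoped Pointwise IsMulCommutative
namespace HodgeRepro.Night3.GSetModel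

open HodgeRepro.CMHodgeOn ExteriorAlgebra

/-! ### The relabelling on the whole exterior algebra -/

section Relabel

variable {G : Type*} [DecidableEq G]

/-- The relabelling `(i, τ) ↦ (i, e τ)` on the whole exterior algebra `⋀^• ℂ^{Fin n × G}` (an algebra map). -/
noncomputable abbrev relabelA (n : ℕ) (e : G ≃ G) :
    ExteriorAlgebra ℂ (V G n) →ₐ[ℂ] ExteriorAlgebra ℂ (V G n) :=
  ExteriorAlgebra.map (relabelV n e).toLinearMap

omit [DecidableEq G] in
/-- `relabelH n e` is `relabelA n e` on the underlying elements. -/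
theorem coe_relabelH (n : ℕ) (e : G ≃ G) (x : Hn G n) :
    (relabelH n e x : ExteriorAlgebra ℂ (V G n)) = relabelA n e x := by
  rw [relabelH_apply]
  exact coe_exteriorPower_map _ x

/-- `relabelA` on a coordinate vector: `ι e_{(i,τ)} ↦ ι e_{(i, e τ)}`. -/
theorem relabelA_ι (n : ℕ) (e : G ≃ G) (p : Fin n × G) :
    relabelA n e (ι ℂ (coordVecOn p)) = ι ℂ (coordVecOn (p.1, e p.2)) := by
  rw [ExteriorAlgebra.map_apply_ι, LinearEquiv.coe_coe, relabelV_coordVecOn]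

end Relabel

/-! ### The monomials, the commutative subalgebra and Weil's class under the relabelling -/

section Monomial

variable {G : Type*} [Group G] [Fintype G] [DecidableEq G] [LinearOrder G]

omit [LinearOrder G] in
/-- **The relabelling carries `(1,1)`-monomials to `(1,1)`-monomials** when `e` commutes with `c`. -/
theorem relabelA_ωc (c : G) (n : ℕ) (e : G ≃ G) (he : ∀ ρ, e (c * ρ) = c * e ρ) (p : Fin n × G) :
    relabelA n e (ωc c n p) = ωc c n (p.1, e p.2) := by
  rw [ωc_apply, ωc_apply, map_mul, relabelA_ι, relabelA_ι, he]

omit [LinearOrder G] in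
/-- The relabelling maps the commutative subalgebra `Ac` into itself. -/
theorem relabelA_mem_Ac (c : G) (n : ℕ) (e : G ≃ G) (he : ∀ ρ, e (c * ρ) = c * e ρ)
    {z : ExteriorAlgebra ℂ (V G n)} (hz : z ∈ Ac c n) : relabelA n e z ∈ Ac c n := by
  have h : (Algebra.adjoin ℂ (Set.range (ωc c n))).map (relabelA n e) ≤ Algebra.adjoin ℂ (Set.range (ωc c n)) := by
    rw [← Algebra.adjoin_image]
    apply Algebra.adjoin_le
    rintro _ ⟨_, ⟨p, rfl⟩, rfl⟩
    rw [relabelA_ωc c n e he p]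
    exact Algebra.subset_adjoin ⟨_, rfl⟩
  exact h (Subalgebra.mem_map.mpr ⟨z, hz, rfl⟩)

omit [LinearOrder G] in
/-- The relabelling restricted to the commutative subalgebra `Ac`, as an algebra map `Ac → Ac`. -/
noncomputable def relabelAc (c : G) (n : ℕ) (e : G ≃ G) (he : ∀ ρ, e (c * ρ) = c * e ρ) : Ac c n →ₐ[ℂ] Ac c n :=
  ((relabelA n e).comp (Ac c n).val).codRestrict (Ac c n) fun z => relabelA_mem_Ac c n e he z.2

omit [LinearOrder G] in
/-- `relabelAc` is `relabelA` on the underlying elements. -/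
theorem coe_relabelAc (c : G) (n : ℕ) (e : G ≃ G) (he : ∀ ρ, e (c * ρ) = c * e ρ) (z : Ac c n) :
    (relabelAc c n e he z : ExteriorAlgebra ℂ (V G n)) = relabelA n e z := rfl

omit [LinearOrder G] in
/-- `relabelAc` on the monomials of `Ac`. -/
theorem relabelAc_ωc' (c : G) (n : ℕ) (e : G ≃ G) (he : ∀ ρ, e (c * ρ) = c * e ρ) (p : Fin n × G) :
    relabelAc c n e he (ωc' c n p) = ωc' c n (p.1, e p.2) :=
  Subtype.ext (relabelA_ωc c n e he p)

omit [LinearOrder G] in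
/-- **The monomial of the conjugate place is minus the monomial**: `ωc (i, cρ) = −ωc (i, ρ)`. -/
theorem ωc_conj {c : G} (hc : IsComplexConj c) (n : ℕ) (i : Fin n) (ρ : G) :
    ωc c n (i, c * ρ) = -ωc c n (i, ρ) := by
  rw [ωc_apply, ωc_apply]
  show ι ℂ (coordVecOn (i, c * ρ)) * ι ℂ (coordVecOn (i, c * (c * ρ))) = _
  rw [hc.mul_mul_cancel, ExtTop.ι_mul_ι_eq_neg]

omit [LinearOrder G] in
/-- `ωc' (i, cρ) = −ωc' (i, ρ)` in `Ac`. -/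
theorem ωc'_conj {c : G} (hc : IsComplexConj c) (n : ℕ) (i : Fin n) (ρ : G) :
    ωc' c n (i, c * ρ) = -ωc' c n (i, ρ) := by
  apply Subtype.ext
  rw [Subalgebra.coe_neg]
  exact ωc_conj hc n i ρ

omit [LinearOrder G] in
/-- **Folding a sum over `G` of monomials to a sum over the CM type**: `G = Φ₀ ⊔ cΦ₀` and `ωc (i, cρ) = −ωc (i, ρ)`
give `∑_{ρ ∈ G} b ρ • ωc (i, ρ) = ∑_{ρ ∈ Φ₀} (b ρ − b (cρ)) • ωc (i, ρ)`. -/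
theorem sum_univ_smul_ωc' {c : G} (hc : IsComplexConj c) {Φ₀ : Finset G} (hΦ : IsCMType c Φ₀) (n : ℕ) (i : Fin n)
    (b : G → ℂ) : ∑ ρ, b ρ • ωc' c n (i, ρ) = ∑ ρ ∈ Φ₀, (b ρ - b (c * ρ)) • ωc' c n (i, ρ) := by
  rw [← Finset.sum_add_sum_compl Φ₀, ← hΦ.smul_eq_compl hc, Finset.smul_finset_def]
  simp only [smul_eq_mul]
  rw [Finset.sum_image (fun x _ y _ h => mul_left_cancel h)]
  simp only [ωc'_conj hc, smul_neg]
  rw [← Finset.sum_add_distrib]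
  refine Finset.sum_congr rfl fun ρ _ => ?_
  rw [sub_smul, sub_eq_add_neg]

omit [Fintype G] [LinearOrder G] in
/-- **The twisted coefficient data** `a^e`: the coefficients of the `(1,1)`-classes read through the relabelling
`e` — `a^e i ρ = [e⁻¹ρ ∈ Φ₀] a i (e⁻¹ρ) − [e⁻¹(cρ) ∈ Φ₀] a i (e⁻¹(cρ))` (only the values on `Φ₀` matter; the
second bracket is the sign of `ωc (i, cρ) = −ωc (i, ρ)` at the places where the twist crosses the CM type). -/
def twistCoeff (c : G) (Φ₀ : Finset G) (e : G ≃ G) {n : ℕ} (a : Fin n → G → ℂ) : Fin n → G → ℂ :=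
  fun i ρ => (if e.symm ρ ∈ Φ₀ then a i (e.symm ρ) else 0) - (if e.symm (c * ρ) ∈ Φ₀ then a i (e.symm (c * ρ)) else 0)

omit [LinearOrder G] in
/-- **The relabelling carries the `(1,1)`-class of a factor to the `(1,1)`-class with the twisted coefficients.** -/
theorem relabelAc_Lclass {c : G} (hc : IsComplexConj c) {Φ₀ : Finset G} (hΦ : IsCMType c Φ₀) (n : ℕ) (e : G ≃ G)
    (he : ∀ ρ, e (c * ρ) = c * e ρ) (a : Fin n → G → ℂ) (i : Fin n) :
    relabelAc c n e he (Lclass c Φ₀ a i) = Lclass c Φ₀ (twistCoeff c Φ₀ e a) i := by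
  rw [Lclass, map_sum]
  simp only [map_smul, relabelAc_ωc']
  have h1 : ∑ ρ ∈ Φ₀, a i ρ • ωc' c n (i, e ρ) = ∑ ρ, (if ρ ∈ Φ₀ then a i ρ else 0) • ωc' c n (i, e ρ) := by
    simp only [ite_smul, zero_smul, Finset.sum_ite_mem, Finset.univ_inter]
  have h2 : ∑ ρ, (if ρ ∈ Φ₀ then a i ρ else 0) • ωc' c n (i, e ρ) =
      ∑ ρ, (if e.symm ρ ∈ Φ₀ then a i (e.symm ρ) else 0) • ωc' c n (i, ρ) := by
    conv_rhs => rw [← Equiv.sum_comp e]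
    simp only [Equiv.symm_apply_apply]
  rw [h1, h2, sum_univ_smul_ωc' hc hΦ n i]
  rfl

omit [LinearOrder G] in
/-- **The relabelling carries Weil's class to Weil's class with the twisted coefficients**: `R_e (Λc a) = Λc (a^e)`. -/
theorem relabelAc_Λc {c : G} (hc : IsComplexConj c) {Φ₀ : Finset G} (hΦ : IsCMType c Φ₀) (n : ℕ) (e : G ≃ G)
    (he : ∀ ρ, e (c * ρ) = c * e ρ) (a : Fin n → G → ℂ) :
    relabelAc c n e he (Λc c Φ₀ a) = Λc c Φ₀ (twistCoeff c Φ₀ e a) := by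
  rw [Λc, Λc, map_prod]
  simp only [map_pow, relabelAc_Lclass hc hΦ n e he a]

end Monomial

/-! ### The top form under the relabelling: the sign of the relabelling permutation -/

section TopForm

variable {R : Type*} [CommRing R] {M : Type*} [AddCommGroup M] [Module R M]
variable {I : Type*} [LinearOrder I] [Fintype I] [DecidableEq I]

/-- **The top form of the wedge of the basis along a permuted enumeration is the sign of the permutation**: with
`s` the increasing enumeration of `I` and `E` a permutation of `I`, `∫ b_{E (s 0)} ∧ ⋯ ∧ b_{E (s (N−1))} = sign E`
(gen 5's `ιMultiDual_univ_ιMulti_of_bijective` with the sign made explicit: `b ∘ E ∘ s = (b ∘ s) ∘ π` for the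
conjugate permutation `π = s⁻¹ ∘ E ∘ s` of `Fin N`, and `sign π = sign E`). -/
theorem ιMultiDual_univ_ιMulti_perm (b : Basis I R M) {N : ℕ} (hN : Fintype.card I = N) (E : Equiv.Perm I) :
    exteriorPower.ιMultiDual R N b (ExtTop.univPC hN)
      (exteriorPower.ιMulti R N (b ∘ (E ∘ Set.powersetCard.ofFinEmbEquiv.symm (ExtTop.univPC hN)))) =
      ((Equiv.Perm.sign E : ℤ) : R) := by
  classical
  set s := Set.powersetCard.ofFinEmbEquiv.symm (ExtTop.univPC hN) with hs
  let se : Fin N ≃ I := Equiv.ofBijective s (ExtTop.bijective_ofFinEmbEquiv_symm_univPC hN)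
  let π : Equiv.Perm (Fin N) := (se.symm.symm.trans E).trans se.symm
  have hπ : (b ∘ ⇑s) ∘ π = b ∘ (E ∘ ⇑s) := by
    funext i
    simp only [Function.comp_apply, π, Equiv.trans_apply, Equiv.symm_symm]
    congr 1
    show s (se.symm (E (se i))) = E (s i)
    rw [← Equiv.ofBijective_apply s (ExtTop.bijective_ofFinEmbEquiv_symm_univPC hN)]
    exact se.apply_symm_apply (E (se i))
  rw [← hπ, AlternatingMap.map_perm, Units.smul_def, map_zsmul]
  have hdiag := exteriorPower.ιMultiDual_apply_diag R N b (ExtTop.univPC hN)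
  rw [exteriorPower.ιMulti_family, ← hs] at hdiag
  rw [hdiag, zsmul_one, Equiv.Perm.sign_symm_trans_trans]

end TopForm

section Perm

variable {G : Type*} [Fintype G] [DecidableEq G] [LinearOrder G]

omit [Fintype G] [DecidableEq G] [LinearOrder G] in
/-- **The relabelling permutation** `E_e : (i, τ) ↦ (i, e τ)` of the lex-ordered index set `Fin n × G`. -/
def relabelPerm (n : ℕ) (e : G ≃ G) : Equiv.Perm (Lex (Fin n × G)) :=
  (toLex : Fin n × G ≃ Lex (Fin n × G)).permCongr (Equiv.prodCongrRight fun _ : Fin n => e)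

omit [Fintype G] [DecidableEq G] [LinearOrder G] in
/-- `relabelPerm n e` unfolded. -/
theorem relabelPerm_apply (n : ℕ) (e : G ≃ G) (x : Lex (Fin n × G)) :
    relabelPerm n e x = toLex ((ofLex x).1, e (ofLex x).2) := rfl

omit [LinearOrder G] in
/-- `relabelV` permutes the lex basis by the relabelling permutation. -/
theorem relabelV_lexBasis (n : ℕ) (e : G ≃ G) (x : Lex (Fin n × G)) :
    relabelV n e (lexBasis n x) = lexBasis n (relabelPerm n e x) := by
  rw [lexBasis_apply, relabelV_coordVecOn, lexBasis_apply, relabelPerm_apply, ofLex_toLex]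

omit [LinearOrder G] in
/-- **The sign of the relabelling permutation is `(sign e)^n`** (`n` disjoint copies of `e`, one per factor), read
in `ℂ`. -/
theorem sign_relabelPerm (n : ℕ) (e : G ≃ G) :
    ((Equiv.Perm.sign (relabelPerm n e) : ℤ) : ℂ) = ((Equiv.Perm.sign e : ℤ) : ℂ) ^ n := by
  rw [relabelPerm, Equiv.Perm.sign_permCongr, Equiv.Perm.sign_prodCongrRight, Finset.prod_const, Finset.card_univ,
    Fintype.card_fin, Units.val_pow_eq_pow_val, Int.cast_pow]

omit [LinearOrder G] in
/-- For even `n` the relabelling permutation is even: its sign is `1` in `ℂ`. -/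
theorem sign_relabelPerm_of_even (n : ℕ) (hn : Even n) (e : G ≃ G) :
    ((Equiv.Perm.sign (relabelPerm n e) : ℤ) : ℂ) = 1 := by
  rw [sign_relabelPerm]
  rcases Int.units_eq_one_or (Equiv.Perm.sign e) with h | h
  · rw [h, Units.val_one, Int.cast_one, one_pow]
  · rw [h, Units.val_neg, Units.val_one, Int.cast_neg, Int.cast_one, hn.neg_one_pow]

/-- **The top form of a relabelled top-degree element is the sign of the relabelling permutation times the top
form**: `∫ R_e w = sign(E_e) · ∫ w` (`w = (∫ w) e_univ`, and `R_e e_univ = b_{E_e (s 0)} ∧ ⋯` has top form `sign E_e`). -/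
theorem ιMultiDual_univPC_map_relabelV (n : ℕ) (e : G ≃ G) {N : ℕ} (hN : Fintype.card (Lex (Fin n × G)) = N)
    (w : ⋀[ℂ]^N (V G n)) :
    exteriorPower.ιMultiDual ℂ N (lexBasis n) (ExtTop.univPC hN)
        (exteriorPower.map N (relabelV n e).toLinearMap w) =
      ((Equiv.Perm.sign (relabelPerm n e) : ℤ) : ℂ) *
        exteriorPower.ιMultiDual ℂ N (lexBasis n) (ExtTop.univPC hN) w := by
  classical
  have hw : w = exteriorPower.ιMultiDual ℂ N (lexBasis n) (ExtTop.univPC hN) w •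
      (lexBasis n).exteriorPower N (ExtTop.univPC hN) := by
    conv_lhs => rw [← ((lexBasis (G := G) n).exteriorPower N).sum_repr w]
    rw [Finset.sum_eq_single (ExtTop.univPC hN)]
    · rw [exteriorPower.basis_repr_apply]
    · intro T _ hT
      exact absurd (Subtype.ext (Finset.eq_univ_of_card _ (by rw [Set.powersetCard.card_eq, hN]))) hT
    · intro h
      exact absurd (Finset.mem_univ _) h
  conv_lhs => rw [hw]
  rw [map_smul, map_smul, smul_eq_mul, mul_comm]
  congr 1
  rw [exteriorPower.basis_apply, exteriorPower.map_apply_ιMulti_family, exteriorPower.ιMulti_family]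
  have hcomp : (⇑(relabelV n e).toLinearMap ∘ ⇑(lexBasis n)) = ⇑(lexBasis n) ∘ ⇑(relabelPerm n e) := by
    funext x
    exact relabelV_lexBasis n e x
  rw [hcomp, Function.comp_assoc]
  exact ιMultiDual_univ_ιMulti_perm (lexBasis n) hN (relabelPerm n e)

end Perm

/-! ### The twist-equivariance of the form -/

section Form

variable {G : Type*} [Group G] [Fintype G] [DecidableEq G] [LinearOrder G]
variable {c : G} (hc : IsComplexConj c) {Φ₀ : Finset G} (hΦ : IsCMType c Φ₀) {n : ℕ}

/-- **THE TWIST-EQUIVARIANCE OF `Q′`**: for `e` commuting with `c`,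
`Q′_{a^e} (R_e x, R_e y) = sign(E_e) · Q′_a (x, y)` — the relabelling of the eigen-coordinates is an isometry from
`(⋀^n, Q′_a)` onto `(⋀^n, Q′_{a^e})` up to the sign of the relabelling permutation (`R_e Λ_a = Λ_{a^e}`, `R_e` is
multiplicative, and the top form picks up `sign E_e`). -/
theorem Qc_relabelH_relabelH (e : G ≃ G) (he : ∀ ρ, e (c * ρ) = c * e ρ) (a : Fin n → G → ℂ) (x y : Hn G n) :
    Qc hc hΦ (twistCoeff c Φ₀ e a) (relabelH n e x) (relabelH n e y) =
      ((Equiv.Perm.sign (relabelPerm n e) : ℤ) : ℂ) * Qc hc hΦ a x y := by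
  rw [Qc_apply, Qc_apply, ← ιMultiDual_univPC_map_relabelV n e (card_lex_eq hc hΦ n)]
  congr 1
  apply Subtype.ext
  rw [coe_exteriorPower_map]
  show (relabelH n e x : ExteriorAlgebra ℂ (V G n)) * (relabelH n e y : ExteriorAlgebra ℂ (V G n)) *
    (Λc c Φ₀ (twistCoeff c Φ₀ e a) : ExteriorAlgebra ℂ (V G n)) = relabelA n e (x * y * Λc c Φ₀ a)
  rw [map_mul, map_mul, coe_relabelH, coe_relabelH, ← relabelAc_Λc hc hΦ n e he a, coe_relabelAc]

/-- **For even `n` the twist is an isometry**: `Q′_{a^e} (R_e x, R_e y) = Q′_a (x, y)` (every zero-sum corner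
product has an even number of factors). -/
theorem Qc_relabelH_relabelH_of_even (hn : Even n) (e : G ≃ G) (he : ∀ ρ, e (c * ρ) = c * e ρ)
    (a : Fin n → G → ℂ) (x y : Hn G n) :
    Qc hc hΦ (twistCoeff c Φ₀ e a) (relabelH n e x) (relabelH n e y) = Qc hc hΦ a x y := by
  rw [Qc_relabelH_relabelH hc hΦ e he a x y, sign_relabelPerm_of_even n hn, one_mul]

/-- **The Galois twist `ρ ↦ ρg` of gen 3 / gen 4** (`relabelH n (Equiv.mulRight g)`, the relabelling part of
`twistEquiv`) carries `Q′_a` to `± Q′_{a^g}`: the form of Lemma P step (2) transports along a twist class. -/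
theorem Qc_twist (g : G) (a : Fin n → G → ℂ) (x y : Hn G n) :
    Qc hc hΦ (twistCoeff c Φ₀ (Equiv.mulRight g) a) (relabelH n (Equiv.mulRight g) x)
        (relabelH n (Equiv.mulRight g) y) =
      ((Equiv.Perm.sign (relabelPerm n (Equiv.mulRight g)) : ℤ) : ℂ) * Qc hc hΦ a x y :=
  Qc_relabelH_relabelH hc hΦ (Equiv.mulRight g) (fun ρ => by simp only [Equiv.coe_mulRight, mul_assoc]) a x y

/-- The Galois twist is an isometry of `Q′` (up to the twisted coefficients) for even `n`. -/
theorem Qc_twist_of_even (hn : Even n) (g : G) (a : Fin n → G → ℂ) (x y : Hn G n) :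
    Qc hc hΦ (twistCoeff c Φ₀ (Equiv.mulRight g) a) (relabelH n (Equiv.mulRight g) x)
        (relabelH n (Equiv.mulRight g) y) = Qc hc hΦ a x y :=
  Qc_relabelH_relabelH_of_even hc hΦ hn (Equiv.mulRight g) (fun ρ => by simp only [Equiv.coe_mulRight, mul_assoc])
    a x y

/-- **The conjugation of the eigen-coordinates `e_{(i,σ)} ↦ e_{(i,cσ)}`** (`relabelH n (Equiv.mulLeft c)`) carries
`Q′_a` to `± Q′_{a^c}`. -/
theorem Qc_conj (a : Fin n → G → ℂ) (x y : Hn G n) :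
    Qc hc hΦ (twistCoeff c Φ₀ (Equiv.mulLeft c) a) (relabelH n (Equiv.mulLeft c) x)
        (relabelH n (Equiv.mulLeft c) y) =
      ((Equiv.Perm.sign (relabelPerm n (Equiv.mulLeft c)) : ℤ) : ℂ) * Qc hc hΦ a x y :=
  Qc_relabelH_relabelH hc hΦ (Equiv.mulLeft c) (fun _ => rfl) a x y

end Form

end HodgeRepro.Night3.GSetModel
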